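import Literature.AnabelianGeometry.SemiGraphs.PSCGraphicConverseIncidence

/-!
# [CombGC] Proposition 1.5: the abutment clause versus distinct branch overgroups

Mochizuki, *A combinatorial version of the Grothendieck conjecture*, Tohoku Math. J. **59** (2007)
[CombGC], §1, Proposition 1.5 (i), author's manuscript p. 12 ("An edge-like subgroup of `Π_G` is
cuspidal (respectively, not cuspidal) if and only if it is contained in precisely one (respectively,
precisely two) verticial subgroup(s)") and its proof, p. 13 ("if `e` is a … nodal edge of `G` that
does not abut to a vertex `v`, then there exists a finite étale `Π_G`-covering `G' → G` which is
trivial over `G_v`, but nontrivial over `G_e`", i.e. `Π_e ≤ δ Π_u δ⁻¹` forces `e` to abut to `u`).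

Proof-only companion of `PSCGraphicity.lean` (seat abc-iut-L3-t4), sequel of
`PSCGraphicConverseIncidence.lean` (wave-4 seat abc-iut-w4-d081, abc-iut cell); the (Ab) form is the
one carried by seat abc-iut-w4-d110's `PSCIncidenceTransport.lean`.  Over the interface
`PSCDatum Π` the COUNTED form of Prop. 1.5 (i) (`EdgeLikeIncidence`) does not name, for a LOOP, the
two verticial subgroups containing its nodal subgroup; the reduction of Prop. 1.5 (ii) ⇐ to
Prop. 1.2 (i) + Prop. 1.5 (i) therefore needs one more input, which the cell's GAP-LEDGER records in
two forms:

* (Ab) the ABUTMENT CLAUSE of the printed proof (row G-w4d110-1; the hypothesis shape of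
  `PSCIncidenceTransport.lean`): `∀ e u δ, Π_e ≤ δ Π_u δ⁻¹ → u ∈ nodeEnds e`;
* (Br) DISTINCT BRANCH OVERGROUPS (row G-w4d081-1; a sharpening of the interface field
  `PSCDatum.nodeGp_le`): every node `e` with `nodeEnds e = s(v₁, v₂)` has branch inclusions
  `γ₁ Π_e ≤ Π_{v₁}`, `γ₂ Π_e ≤ Π_{v₂}` with `γ₁⁻¹Π_{v₁} ≠ γ₂⁻¹Π_{v₂}` (for the data of a pointed
  stable curve: the two branches of a node are stabilised by distinct vertices of the universal
  pro-tree).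

This file proves, for EVERY datum satisfying the conclusions of Prop. 1.2 (i) (verticial and
edge-like cases) and of Prop. 1.5 (i), that **(Ab) ⟺ (Br)** (`abutment_of_branches`,
`branches_of_abutment`, `branches_iff_abutment`): so a single repair of the interface (a
`PSCDatum` field recording (Br)) discharges both rows, and either form may be fed to the Prop. 1.5
(ii) ⇐ reduction (`PSCGraphicConverseIncidence.lean`, whose key step
`mem_nodeEnds_iff_exists_le_of_branches` says: under (Br) at `e`, the vertices of `e` are exactly the
`u` with `Π_e ≤` a conjugate of `Π_u`).

Pure proofs; no definitions; no new named facts (both (Ab) and (Br) are explicit hypotheses);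
nothing here takes a side on [IUTchIII] Cor. 3.12. [cite: MochizukiCombGC2007, Prop 1.5(i) pp.12-13]
-/

noncomputable section

namespace Literature.AnabelianGeometry.SemiGraphs

namespace PSCDatum

open scoped Pointwise

universe u

variable {P : Type u} [Group P] [TopologicalSpace P] {G : PSCDatum P}

/-- **(Br) ⟹ (Ab).**  If every node of `G` has distinct branch overgroups, then the abutment clause
of the proof of Prop. 1.5 (i) holds: `Π_e ≤ δ Π_u δ⁻¹` forces `u ∈ nodeEnds e` (given the conclusions
of Prop. 1.2 (i) and Prop. 1.5 (i)). [cite: MochizukiCombGC2007, Prop 1.5(i) p.13] -/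
theorem abutment_of_branches (hV : G.VerticialOpenInterDeterminesVertex)
    (hE : G.EdgeLikeOpenInterDeterminesEdge) (hInc : G.EdgeLikeIncidence)
    (hbr : ∀ e : G.graph.N, ∃ (v₁ v₂ : G.graph.V) (γ₁ γ₂ : ConjAct P),
      G.graph.nodeEnds e = s(v₁, v₂) ∧ γ₁ • G.nodeGp e ≤ G.vertGp v₁ ∧
        γ₂ • G.nodeGp e ≤ G.vertGp v₂ ∧ γ₁⁻¹ • G.vertGp v₁ ≠ γ₂⁻¹ • G.vertGp v₂)
    (e : G.graph.N) (u : G.graph.V) (δ : ConjAct P) (h : G.nodeGp e ≤ δ • G.vertGp u) :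
    u ∈ G.graph.nodeEnds e := by
  obtain ⟨v₁, v₂, γ₁, γ₂, he, h₁, h₂, hne⟩ := hbr e
  exact (mem_nodeEnds_iff_exists_le_of_branches hV hE hInc he h₁ h₂ hne u).mpr ⟨δ, h⟩

/-- **(Ab) ⟹ (Br).**  Conversely, under the abutment clause every node has distinct branch
overgroups: if the two recorded branch inclusions of `e` happen to land in the SAME conjugate of
`Π_{v₁}` (so `v₁ = v₂` by Prop. 1.2 (i): `e` is a loop), the second verticial overgroup of `Π_e`
provided by the count of Prop. 1.5 (i) is, by (Ab), a conjugate of `Π_{v₁}` as well, and serves as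
the second branch overgroup. [cite: MochizukiCombGC2007, Prop 1.5(i) p.13] -/
theorem branches_of_abutment (hV : G.VerticialOpenInterDeterminesVertex)
    (hE : G.EdgeLikeOpenInterDeterminesEdge) (hInc : G.EdgeLikeIncidence)
    (hAb : ∀ (e : G.graph.N) (u : G.graph.V) (δ : ConjAct P),
      G.nodeGp e ≤ δ • G.vertGp u → u ∈ G.graph.nodeEnds e)
    (e : G.graph.N) :
    ∃ (v₁ v₂ : G.graph.V) (γ₁ γ₂ : ConjAct P),
      G.graph.nodeEnds e = s(v₁, v₂) ∧ γ₁ • G.nodeGp e ≤ G.vertGp v₁ ∧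
        γ₂ • G.nodeGp e ≤ G.vertGp v₂ ∧ γ₁⁻¹ • G.vertGp v₁ ≠ γ₂⁻¹ • G.vertGp v₂ := by
  obtain ⟨v₁, v₂, he, ⟨γ₁, h₁⟩, ⟨γ₂, h₂⟩⟩ := G.nodeGp_le e
  by_cases hd : γ₁⁻¹ • G.vertGp v₁ = γ₂⁻¹ • G.vertGp v₂
  swap
  · exact ⟨v₁, v₂, γ₁, γ₂, he, h₁, h₂, hd⟩
  -- the degenerate recording: both branches in the same conjugate; then `e` is a loop at `v₁`
  have hv : v₁ = v₂ := eq_of_smul_vertGp_eq hV hd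
  subst hv
  have h₁' : G.nodeGp e ≤ γ₁⁻¹ • G.vertGp v₁ := Subgroup.pointwise_smul_subset_iff.mp h₁
  have hnod : G.IsNodal (G.nodeGp e) := ⟨e, 1, (one_smul _ _).symm⟩
  have hnc : ¬ G.IsCuspidal (G.nodeGp e) := not_isCuspidal_of_isNodal hE hnod
  obtain ⟨A₁, A₂, hA, hall⟩ := ((hInc _ (Or.inl hnod)).2).mp hnc
  -- the OTHER verticial overgroup given by the count of Prop. 1.5 (i)
  obtain ⟨B, ⟨hBv, hBle⟩, hBne⟩ :
      ∃ B, (G.IsVerticial B ∧ G.nodeGp e ≤ B) ∧ B ≠ γ₁⁻¹ • G.vertGp v₁ := by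
    rcases (hall _).mp ⟨⟨v₁, γ₁⁻¹, rfl⟩, h₁'⟩ with h | h
    · exact ⟨A₂, (hall A₂).mpr (Or.inr rfl), fun h' => hA (h.symm.trans h'.symm)⟩
    · exact ⟨A₁, (hall A₁).mpr (Or.inl rfl), fun h' => hA (h'.trans h)⟩
  obtain ⟨w, δ, rfl⟩ := hBv
  have hw : w = v₁ := by
    have hmem := hAb e w δ hBle
    rw [he, Sym2.mem_iff] at hmem
    rcases hmem with h | h <;> exact h
  subst hw
  refine ⟨w, w, γ₁, δ⁻¹, he, h₁, Subgroup.pointwise_smul_subset_iff.mpr (by rwa [inv_inv]), ?_⟩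
  rw [inv_inv]
  exact fun h => hBne h.symm

/-- **(Br) ⟺ (Ab)** for a datum satisfying the conclusions of Prop. 1.2 (i) and Prop. 1.5 (i): the
two recorded forms of the missing interface link (GAP-LEDGER rows G-w4d081-1 and G-w4d110-1 of the
abc-iut cell) are equivalent. [cite: MochizukiCombGC2007, Prop 1.5(i) pp.12-13] -/
theorem branches_iff_abutment (hV : G.VerticialOpenInterDeterminesVertex)
    (hE : G.EdgeLikeOpenInterDeterminesEdge) (hInc : G.EdgeLikeIncidence) :
    (∀ e : G.graph.N, ∃ (v₁ v₂ : G.graph.V) (γ₁ γ₂ : ConjAct P),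
      G.graph.nodeEnds e = s(v₁, v₂) ∧ γ₁ • G.nodeGp e ≤ G.vertGp v₁ ∧
        γ₂ • G.nodeGp e ≤ G.vertGp v₂ ∧ γ₁⁻¹ • G.vertGp v₁ ≠ γ₂⁻¹ • G.vertGp v₂) ↔
    ∀ (e : G.graph.N) (u : G.graph.V) (δ : ConjAct P),
      G.nodeGp e ≤ δ • G.vertGp u → u ∈ G.graph.nodeEnds e :=
  ⟨abutment_of_branches hV hE hInc, branches_of_abutment hV hE hInc⟩

/-- The same equivalence for the loop form of (Ab) used by `abutment_of_loops`: (Br) implies that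
a loop `e` at `v` has `Π_e` inside conjugates of `Π_v` only. [cite: MochizukiCombGC2007, Prop 1.5(i) p.13] -/
theorem loop_abutment_of_branches (hV : G.VerticialOpenInterDeterminesVertex)
    (hE : G.EdgeLikeOpenInterDeterminesEdge) (hInc : G.EdgeLikeIncidence)
    (hbr : ∀ e : G.graph.N, ∃ (v₁ v₂ : G.graph.V) (γ₁ γ₂ : ConjAct P),
      G.graph.nodeEnds e = s(v₁, v₂) ∧ γ₁ • G.nodeGp e ≤ G.vertGp v₁ ∧
        γ₂ • G.nodeGp e ≤ G.vertGp v₂ ∧ γ₁⁻¹ • G.vertGp v₁ ≠ γ₂⁻¹ • G.vertGp v₂)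
    (e : G.graph.N) (v : G.graph.V) (he : G.graph.nodeEnds e = s(v, v)) (u : G.graph.V)
    (δ : ConjAct P) (h : G.nodeGp e ≤ δ • G.vertGp u) : u = v := by
  have hmem := abutment_of_branches hV hE hInc hbr e u δ h
  rw [he, Sym2.mem_iff] at hmem
  rcases hmem with h | h <;> exact h

/-- Over an origin predicate `Ω`: for data of type `Ω` satisfying the printed Prop. 1.2 (i) and
Prop. 1.5 (i) (`OpenInterDeterminesComponentHolds Ω`, `EdgeLikeIncidenceHolds Ω`), the two forms of
the link agree datum by datum. [cite: MochizukiCombGC2007, Prop 1.5(i) pp.12-13] -/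
theorem branches_iff_abutment_of_holds (Ω : PSCOrigin.{u})
    (h12 : OpenInterDeterminesComponentHolds Ω) (h15 : EdgeLikeIncidenceHolds Ω)
    {Q : Type u} [Group Q] [TopologicalSpace Q] [IsTopologicalGroup Q] (G : PSCDatum Q)
    (hG : Ω.IsOfPSCType G) :
    (∀ e : G.graph.N, ∃ (v₁ v₂ : G.graph.V) (γ₁ γ₂ : ConjAct Q),
      G.graph.nodeEnds e = s(v₁, v₂) ∧ γ₁ • G.nodeGp e ≤ G.vertGp v₁ ∧
        γ₂ • G.nodeGp e ≤ G.vertGp v₂ ∧ γ₁⁻¹ • G.vertGp v₁ ≠ γ₂⁻¹ • G.vertGp v₂) ↔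
    ∀ (e : G.graph.N) (u : G.graph.V) (δ : ConjAct Q),
      G.nodeGp e ≤ δ • G.vertGp u → u ∈ G.graph.nodeEnds e :=
  branches_iff_abutment (h12 G hG).1 (h12 G hG).2.1 (h15 G hG)

end PSCDatum

end Literature.AnabelianGeometry.SemiGraphs

end
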